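import Summits.QuantumAdvantage.QuantumAdvantage.Theorems.ResponseDialF

/-! # ResponseDialGA — ResponseDial REV 1 delta part 2/6 (mechanical split for landing; content verbatim; scopes re-opened with their variables) -/

set_option linter.dupNamespace false
noncomputable section
open scoped Classical

namespace Summit.QuantumAdvantage.QuantumAdvantage.Theorems.ResponseDial
open Finset
open Literature.Computability.QuantumComplexity Literature.Computability.QuantumComplexity.RingHLF
open Literature.Computability.MetaComplexity Literature.Computability.MetaComplexity.Smolensky
open Summit.QuantumAdvantage.AdviceFreeQNC0
open Summit.QuantumAdvantage.QuantumAdvantage.Theorems.AnchorDial (outB dev cN orbF orbL orbL_cons fz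
  cN_orbF_cast oddZeros_orbF win_iff gCond_iff_cN card_filter_orbF orbF_false flip2 card_odd_ge loss_shape_mono)
open Summit.QuantumAdvantage.QuantumAdvantage.Theorems.AnchorDial.Core (ct sg)
open Summit.QuantumAdvantage.QuantumAdvantage.Theorems.HolonomyDial (gCond tPoly tPoly_apply tPoly_mem card_odd_le
  xorP xorP_mem xorP_apply_bool mono_singleton_apply indP indP_mem indP_apply)
open Summit.QuantumAdvantage.QuantumAdvantage.Theorems.StabilizerDial (apIdx apStrat apStrat_mem bitP bitP_apStrat
  pad rel_pad_iff outB_pad_zero pad_mem StabFew rowMask bitP_pad mem_dev_pad_apStrat_iff BlockRec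
  blockSelect_of_fewLocus goodBound_of_blockRec fibreIdentityAt_of_block oddSliceBound_holds eventually_polylog
  side_bounds)
open Summit.QuantumAdvantage.QuantumAdvantage.Theorems.LocusDial (Coverable FewLocus)
open Summit.QuantumAdvantage.QuantumAdvantage.Theorems.SparsityDial (real_loss_of_frac AntipodalLoss3 stabFew_mono_mr
  one_le_logpow)
open Summit.QuantumAdvantage.QuantumAdvantage.Theses.SparsityDial (DenseGenericLoss3)

/-! ## §10  THE COUNTER LAW: the rung `HalfCounterLoss3` is a THEOREM (data-dependent orbit certificates).
The half-counter family does NOT respond additively (§8), but its response to the five pair-flips at the first-half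
sites `2, 6, 10, 14, 18` is the next simplest thing: the first-half deviation indicators are FROZEN, and the whole
counter block `{0} ∪ [N/2, N)` toggles together by the bit `[L + Σ_{i ∈ ε} δ_i ≡ 0 (mod 3)]` — a MOD-3 COUNTER of the
flipped odd cells (`L = lodd x`, `δ_i ∈ {1, 2}` the increment of the `i`-th odd cell).  For the base points with all
five flipped odd cells holding `0` (`δ ≡ 1`) and a sign change between sites 1 and 2 (forced by `x_8 = x_9 = x_10 = 1`,
`x_7 = 0`), the extended orbit system has a dual certificate for EVERY remaining datum `(z, L)` (48 of them, each of
weight 5: `certC`, checked by `decide`) — so each such base point has a losing orbit image.  The conditioned base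
points are a `2⁻⁹` fraction of the cube up to parity repair (`fixup`: 512-to-1 at most), whence
`#odd ≤ 16384 · #{odd losers}` and `HalfCounterLoss3` with `C = 1` (`halfCounterLoss3`).  The 18 data `(z, L)` with
`z` constant on four consecutive sites have NO certificate (scratch `hc_gen.py`): the certificate method is genuinely
DATA-DEPENDENT here, which is why the base points are conditioned. -/

section Counter
variable {N : ℕ}

/-- the number of flagged sites, in `𝔽₃` (the counter increment when every flipped odd cell holds `0`). -/
def cnt3 (ε : Fin 5 → Bool) : ZMod 3 :=
  (if ε 0 = true then 1 else 0) + (if ε 1 = true then 1 else 0) + (if ε 2 = true then 1 else 0) +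
    (if ε 3 = true then 1 else 0) + (if ε 4 = true then 1 else 0)

/-- the counter block's deviation bit at orbit point `j`, for counter base `L`. -/
def tC (L : ZMod 3) (j : ℕ) : Bool := decide (L + cnt3 (εOf j) = 0)

/-- dual certificates of the counter-extended orbit system, indexed by the sign vector and the counter base
(`0` = no certificate exists / none needed; the 48 entries with `z₁ ≠ z₂` are the ones used). -/
def certC : Bool → Bool → Bool → Bool → Bool → ℕ → ℕ
  | false, false, false, false, false, 0 => 0
  | false, false, false, false, false, 1 => 0
  | false, false, false, false, false, 2 => 0
  | false, false, false, false, true, 0 => 0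
  | false, false, false, false, true, 1 => 0
  | false, false, false, false, true, 2 => 0
  | false, false, false, true, false, 0 => 2290122760
  | false, false, false, true, false, 1 => 1111506946
  | false, false, false, true, false, 2 => 2151694528
  | false, false, false, true, true, 0 => 75513889
  | false, false, false, true, true, 1 => 2151678488
  | false, false, false, true, true, 2 => 2692759568
  | false, false, true, false, false, 0 => 2181038101
  | false, false, true, false, false, 1 => 2818572353
  | false, false, true, false, false, 2 => 1145077768
  | false, false, true, false, true, 0 => 143147012
  | false, false, true, false, true, 1 => 1111506946
  | false, false, true, false, true, 2 => 143147012
  | false, false, true, true, false, 0 => 42483728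
  | false, false, true, true, false, 1 => 268730378
  | false, false, true, true, false, 2 => 2822832128
  | false, false, true, true, true, 0 => 302547008
  | false, false, true, true, true, 1 => 1090519208
  | false, false, true, true, true, 2 => 2822832128
  | false, true, false, false, false, 0 => 3909091328
  | false, true, false, false, false, 1 => 1879048336
  | false, true, false, false, false, 2 => 2533359616
  | false, true, false, false, true, 0 => 3909091328
  | false, true, false, false, true, 1 => 537411589
  | false, true, false, false, true, 2 => 2533359616
  | false, true, false, true, false, 0 => 3909091328
  | false, true, false, true, false, 1 => 1145061380
  | false, true, false, true, false, 2 => 2533359616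
  | false, true, false, true, true, 0 => 3909091328
  | false, true, false, true, true, 1 => 1090519082
  | false, true, false, true, true, 2 => 2533359616
  | false, true, true, false, false, 0 => 3767533568
  | false, true, true, false, false, 1 => 1119944704
  | false, true, true, false, false, 2 => 572538884
  | false, true, true, false, true, 0 => 3767533568
  | false, true, true, false, true, 1 => 1119944704
  | false, true, true, false, true, 2 => 547373072
  | false, true, true, true, false, 0 => 3758133248
  | false, true, true, true, false, 1 => 1107345664
  | false, true, true, true, false, 2 => 2151694528
  | false, true, true, true, true, 0 => 0
  | false, true, true, true, true, 1 => 0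
  | false, true, true, true, true, 2 => 0
  | true, false, false, false, false, 0 => 0
  | true, false, false, false, false, 1 => 0
  | true, false, false, false, false, 2 => 0
  | true, false, false, false, true, 0 => 3758133248
  | true, false, false, false, true, 1 => 1107345664
  | true, false, false, false, true, 2 => 2151694528
  | true, false, false, true, false, 0 => 3767533568
  | true, false, false, true, false, 1 => 1119944704
  | true, false, false, true, false, 2 => 547373072
  | true, false, false, true, true, 0 => 3767533568
  | true, false, false, true, true, 1 => 1119944704
  | true, false, false, true, true, 2 => 572538884
  | true, false, true, false, false, 0 => 3909091328
  | true, false, true, false, false, 1 => 1090519082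
  | true, false, true, false, false, 2 => 2533359616
  | true, false, true, false, true, 0 => 3909091328
  | true, false, true, false, true, 1 => 1145061380
  | true, false, true, false, true, 2 => 2533359616
  | true, false, true, true, false, 0 => 3909091328
  | true, false, true, true, false, 1 => 537411589
  | true, false, true, true, false, 2 => 2533359616
  | true, false, true, true, true, 0 => 3909091328
  | true, false, true, true, true, 1 => 1879048336
  | true, false, true, true, true, 2 => 2533359616
  | true, true, false, false, false, 0 => 302547008
  | true, true, false, false, false, 1 => 1090519208
  | true, true, false, false, false, 2 => 2822832128
  | true, true, false, false, true, 0 => 42483728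
  | true, true, false, false, true, 1 => 268730378
  | true, true, false, false, true, 2 => 2822832128
  | true, true, false, true, false, 0 => 143147012
  | true, true, false, true, false, 1 => 1111506946
  | true, true, false, true, false, 2 => 143147012
  | true, true, false, true, true, 0 => 2181038101
  | true, true, false, true, true, 1 => 2818572353
  | true, true, false, true, true, 2 => 1145077768
  | true, true, true, false, false, 0 => 75513889
  | true, true, true, false, false, 1 => 2151678488
  | true, true, true, false, false, 2 => 2692759568
  | true, true, true, false, true, 0 => 2290122760
  | true, true, true, false, true, 1 => 1111506946
  | true, true, true, false, true, 2 => 2151694528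
  | true, true, true, true, false, 0 => 0
  | true, true, true, true, false, 1 => 0
  | true, true, true, true, false, 2 => 0
  | true, true, true, true, true, 0 => 0
  | true, true, true, true, true, 1 => 0
  | true, true, true, true, true, 2 => 0
  | _, _, _, _, _, _ => 0

/-- the certificate's orbit points. -/
def lamC (z : Fin 5 → Bool) (L : ZMod 3) : List ℕ :=
  (List.range 32).filter fun j => (certC (z 0) (z 1) (z 2) (z 3) (z 4) L.val).testBit j

/-- what a counter certificate must satisfy: odd size; even exclusion counts per (group, phase) for the frozen
first-half block; even counts of «counter bit set ∧ not excluded» for the two groups `0` and `5` met by the counter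
block `{0} ∪ [N/2, N)`. -/
abbrev CertOKC (z : Fin 5 → Bool) (L : ZMod 3) (Λ : List ℕ) : Prop :=
  Λ.length % 2 = 1 ∧
    (∀ g : Fin 6, ∀ c : ZMod 3, (Λ.countP fun j => decide (c + sF z (εOf j) g.val ≠ 2)) % 2 = 0) ∧
    (∀ c : ZMod 3, (Λ.countP fun j => tC L j && decide (c + sF z (εOf j) 0 ≠ 2)) % 2 = 0) ∧
    (∀ c : ZMod 3, (Λ.countP fun j => tC L j && decide (c + sF z (εOf j) 5 ≠ 2)) % 2 = 0)

/-- **CORE OF THE COUNTER LAW (finite check, `decide`)**: every datum with a sign change between sites 1 and 2 has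
a certificate. -/
theorem certOKC_lam5 : ∀ z₀ z₁ z₂ z₃ z₄ : Bool, z₁ ≠ z₂ → ∀ L : ZMod 3,
    CertOKC ![z₀, z₁, z₂, z₃, z₄] L (lamC ![z₀, z₁, z₂, z₃, z₄] L) := by
  intro z₀ z₁ z₂ z₃ z₄ h
  cases z₀ <;> cases z₁ <;> cases z₂ <;> cases z₃ <;> cases z₄ <;>
    first | exact absurd rfl h | decide

/-- ResponseDialGA helper `certOKC_lam` (decomp-qadv land package; see the module docstring). -/
theorem certOKC_lam (z : Fin 5 → Bool) (hz : z 1 ≠ z 2) (L : ZMod 3) : CertOKC z L (lamC z L) := by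
  have h := certOKC_lam5 (z 0) (z 1) (z 2) (z 3) (z 4) hz L
  rw [← eq_vec5 z] at h
  exact h

/-- the five first-half flip sites `2, 6, 10, 14, 18`. -/
def hcSite (i : Fin 5) : ℕ := 2 + 4 * i.val

/-- ResponseDialGA helper `hcSite_sep` (decomp-qadv land package; see the module docstring). -/
theorem hcSite_sep : ∀ i j : Fin 5, i < j → hcSite i + 2 ≤ hcSite j := by
  intro i j hij
  have : i.val < j.val := hij
  unfold hcSite; omega

/-- ResponseDialGA helper `hcSite_le` (decomp-qadv land package; see the module docstring). -/
theorem hcSite_le (hN : 22 ≤ N) : ∀ i : Fin 5, hcSite i + 3 ≤ N := by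
  intro i; have := i.isLt; unfold hcSite; omega

/-- ResponseDialGA helper `oddSite_hcSite` (decomp-qadv land package; see the module docstring). -/
theorem oddSite_hcSite (hbN : ∀ i : Fin 5, hcSite i + 3 ≤ N) (i : Fin 5) :
    (oddSite hbN i).val = 4 * i.val + 3 := by
  unfold oddSite hcSite; dsimp only; split_ifs with h <;> omega

/-- the conditioned base points: flipped odd cells `3, 7, 11, 15, 19` hold `0`, cells `8, 9, 10` hold `1`. -/
def FixC (x : Fin N → Bool) : Prop :=
  (∀ j : Fin N, (j.val = 3 ∨ j.val = 7 ∨ j.val = 11 ∨ j.val = 15 ∨ j.val = 19) → x j = false) ∧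
    (∀ j : Fin N, (j.val = 8 ∨ j.val = 9 ∨ j.val = 10) → x j = true)

/-- on the first half-cycle the half-counter family deviates exactly like the antipodal family. -/
theorem mem_dev_hc_first (y : Fin N → Bool) (k : Fin N) (hk : 1 ≤ k.val ∧ k.val < N / 2) :
    k ∈ dev (fun i : Fin N => hcStrat i) y ↔ y (apIdx k) = true := by
  have h := mem_dev_apStrat y k
  unfold Summit.QuantumAdvantage.QuantumAdvantage.Theorems.AnchorDial.dev at h ⊢
  rw [mem_filter] at h ⊢
  have e : (fun i : Fin N => hcStrat i) k y = (fun i : Fin N => apStrat i) k y := by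
    show hcStrat k y = apStrat k y
    rw [hcStrat_agree k hk.1 hk.2]
  rw [e]
  exact h

/-- ResponseDialGA helper `sgn3_false` (decomp-qadv land package; see the module docstring). -/
theorem sgn3_false : sgn3 false = 1 := rfl

/-- along the orbit of a conditioned base point the counter bit is `[L + |ε| ≡ 0]`. -/
theorem qbit_orbF_hc (hN : 22 ≤ N) (ε : Fin 5 → Bool) (x : Fin N → Bool)
    (hx0 : ∀ i : Fin 5, x (oddSite (hcSite_le hN) i) = false) :
    qbit (orbF hcSite ε x) = decide ((lodd : CubeFn (ZMod 3) N) x + cnt3 ε = 0) := by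
  unfold qbit
  rw [lodd_orbF hcSite_sep (hcSite_le hN) ε x]
  have hs : ∑ i ∈ (univ : Finset (Fin 5)).filter (fun i => ε i = true), sgn3 (x (oddSite (hcSite_le hN) i)) =
      cnt3 ε := by
    rw [sum_congr rfl (fun i _ => by rw [hx0 i, sgn3_false] :
      ∀ i ∈ (univ : Finset (Fin 5)).filter (fun i => ε i = true), sgn3 (x (oddSite (hcSite_le hN) i)) = (1 : ZMod 3)),
      sum_filter, Fin.sum_univ_five]
    rfl
  rw [hs]


end Counter
end Summit.QuantumAdvantage.QuantumAdvantage.Theorems.ResponseDial
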